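import Summits.QuantumFields.QCD.Theses.MultibosonBridge

/-!
# QuantumFields / QCD / MultibosonBridge — refutation of `AdmissibleRootsExist` as typed

`AdmissibleRootsExist` (stmt-QuantumFields-9603) bounds, at `d = 0`, the Chebyshev coefficient mass
`∑ |b_j|` of `t q(t) = ∑ b_j T_j(t/c)` by `δ⁻⁸` UNIFORMLY IN `ε`; but `f(θ) = c cos θ · q(c cos θ) =
∑ b_j cos(jθ)` is `δ`-close to `sign(cos θ)` off a window of width `≍ √ε`, and testing
`g(t) = f(π/2 − t) − f(π/2 + t) = ∑ 2b_j sin(jπ/2) sin(jt)` against the conjugate Dirichlet kernel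
`K_n = ∑_{m<n} sin(mt) ≥ −1/2` (`n = 2M`) gives `π δ⁻⁸ ≥ ∫₀^π g K_n ≥ (1−δ) log(M+1) − 2δπ − 4(1+δ)`,
false for `δ = 4/5`, `c = 4`, `M = 2^256`, `ε = (2/(π·2M))²`. Fix for the planner: let the
certificate amplitude depend on `ε` (any admissible polynomial has `∑|b_j| ≥ ((1−δ)/π) log(1/ε) − O(1)`).
-/

noncomputable section

open Real MeasureTheory Set Finset intervalIntegral

namespace Summit.QuantumFields.QCD.Theorems

/-- **Record of the replaced route item `AdmissibleRootsExist`** = stmt-QuantumFields-9603 (ledger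
signature verbatim; NOT a route item; restated by the route as `AdmissibleRootsExistR`): re-declared
under its original name and definiens only so that the refutation below (closed the item `refuted`
at 04f766cc9877; append-only statement text) keeps elaborating. FALSE as typed, see below. -/
def _root_.Summit.QuantumFields.QCD.Theses.MultibosonBridge.AdmissibleRootsExist : Prop :=
    ∃ C : ℝ, 0 < C ∧ ∀ (ε δ c : ℝ) (ℓ : ℕ), 0 < ε → ε < 1 → 0 < δ → δ < 1 → 4 ≤ c → C * Real.log (2
    / δ) ^ 2 / Real.sqrt ε ≤ ℓ → ∃ l : List ℂ, (l.length : ℝ) ≤ C * Real.log (2 / δ) ^ 2 / Real.sqrt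
    ε ∧ (∀ z ∈ l, z.im ≠ 0) ∧ (∀ t : ℝ, Real.sqrt ε * c ≤ |t| → |t| ≤ c → |t| * ((l.map fun z => ‖(t
    : ℂ) - z‖ ^ 2).prod) - 1 ≤ δ ∧ 1 - |t| * ((l.map fun z => ‖(t : ℂ) - z‖ ^ 2).prod) ≤ δ) ∧ (∀ t :
    ℝ, |t| ≤ Real.sqrt ε * c → |t| * ((l.map fun z => ‖(t : ℂ) - z‖ ^ 2).prod) ≤ 1 + δ) ∧ ∃ (D : ℕ)
    (b : ℕ → ℝ), (∀ t : ℝ, |t| ≤ c → t * ((l.map fun z => ‖(t : ℂ) - z‖ ^ 2).prod) = ∑ j ∈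
    Finset.range (D + 1), b j * (Polynomial.Chebyshev.T ℝ (j : ℤ)).eval (t / c)) ∧ ∀ d : ℕ, (∑ j ∈
    Finset.range (D + 1), if d ≤ j then |b j| else 0) ≤ δ⁻¹ ^ 8 * Real.exp (-((d : ℝ) / ℓ))

set_option maxHeartbeats 1600000 in
/-- Refutes `MultibosonBridge.AdmissibleRootsExist` (stmt-QuantumFields-9603): its Chebyshev
certificate at `d = 0` bounds the coefficient mass `∑_j |b_j|` of `t q(t) = ∑ b_j T_j(t/c)` by
`δ⁻⁸` uniformly in `ε`, whereas every polynomial with `|t| q(t) = 1 ± δ` on `√ε c ≤ |t| ≤ c` and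
`|t| q(t) ≤ 1 + δ` on the gap is a near-square-wave in `θ = arccos(t/c)` whose coefficient mass is
`≥ ((1−δ)/π) log(1/ε) − O(1)` (conjugate-Dirichlet-kernel test + sine orthogonality on `[0, π]`).
Witness: `δ = 4/5`, `c = 4`, `ε = (2/(π·2M))²`, `M = 2^256`. [folklore] -/
theorem MultibosonBridgeAdmissibleRootsExist_refuted :
    ¬ Summit.QuantumFields.QCD.Theses.MultibosonBridge.AdmissibleRootsExist := by
  rintro ⟨C, -, h⟩
  /- elementary trigonometric integrals -/
  have two_mul_sin_mul_sin : ∀ a b : ℝ, 2 * sin a * sin b = cos (a - b) - cos (a + b) := by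
    intro a b; rw [cos_sub, cos_add]; ring
  have integral_sin_const_mul : ∀ {r : ℝ}, r ≠ 0 → ∀ a b : ℝ,
      ∫ t in a..b, sin (r * t) = (cos (r * a) - cos (r * b)) / r := by
    intro r hr a b
    rw [intervalIntegral.integral_comp_mul_left (a := a) (b := b) sin hr, integral_sin, smul_eq_mul,
      inv_mul_eq_div]
  have integral_cos_const_mul : ∀ {r : ℝ}, r ≠ 0 → ∀ a b : ℝ,
      ∫ t in a..b, cos (r * t) = (sin (r * b) - sin (r * a)) / r := by
    intro r hr a b
    rw [intervalIntegral.integral_comp_mul_left (a := a) (b := b) cos hr, integral_cos, smul_eq_mul,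
      inv_mul_eq_div]
  -- orthogonality of sines on `[0, π]`, index `0` included
  have integral_sin_mul_sin : ∀ j m : ℕ, ∫ t in (0:ℝ)..π, sin ((j:ℝ) * t) * sin ((m:ℝ) * t)
      = if j = m ∧ 1 ≤ m then π / 2 else 0 := by
    intro j m
    by_cases hjm : j = m
    · subst hjm
      rcases Nat.eq_zero_or_pos j with rfl | hj
      · simp
      rw [if_pos ⟨rfl, hj⟩]
      have h2 : (2 * (j:ℝ)) ≠ 0 := by positivity
      have hint : ∀ t, sin ((j:ℝ) * t) * sin ((j:ℝ) * t) = (1/2) * (1 - cos ((2 * (j:ℝ)) * t)) := by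
        intro t
        have := two_mul_sin_mul_sin ((j:ℝ) * t) ((j:ℝ) * t)
        rw [sub_self, cos_zero] at this
        rw [show (2 * (j:ℝ)) * t = (j:ℝ) * t + (j:ℝ) * t by ring]
        linear_combination this / 2
      simp_rw [hint]
      rw [intervalIntegral.integral_const_mul, intervalIntegral.integral_sub (by simp)
        ((by fun_prop : Continuous _).intervalIntegrable _ _), intervalIntegral.integral_const,
        integral_cos_const_mul h2]
      have e : sin (2 * (j:ℝ) * π) = 0 := by have := sin_nat_mul_pi (2 * j); push_cast at this; exact this
      simp [e]
      ring
    · rw [if_neg (fun h' => hjm h'.1)]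
      have h1 : ((j:ℝ) - m) ≠ 0 := sub_ne_zero.mpr (by exact_mod_cast hjm)
      have h2 : ((j:ℝ) + m) ≠ 0 := by
        have : (0:ℝ) < (j:ℝ) + m := by exact_mod_cast (show 0 < j + m by omega)
        exact this.ne'
      have hint : ∀ t, sin ((j:ℝ) * t) * sin ((m:ℝ) * t)
          = (1/2) * (cos (((j:ℝ) - m) * t) - cos (((j:ℝ) + m) * t)) := by
        intro t
        have := two_mul_sin_mul_sin ((j:ℝ) * t) ((m:ℝ) * t)
        rw [sub_mul, add_mul]
        linear_combination this / 2
      simp_rw [hint]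
      rw [intervalIntegral.integral_const_mul,
        intervalIntegral.integral_sub ((by fun_prop : Continuous _).intervalIntegrable _ _)
          ((by fun_prop : Continuous _).intervalIntegrable _ _),
        integral_cos_const_mul h1, integral_cos_const_mul h2]
      have e1 : sin (((j:ℝ) - m) * π) = 0 := by have := sin_int_mul_pi ((j:ℤ) - m); push_cast at this; exact this
      have e2 : sin (((j:ℝ) + m) * π) = 0 := by have := sin_nat_mul_pi (j + m); push_cast at this; exact this
      simp [e1, e2]
  /- the conjugate Dirichlet kernel `K n t = ∑_{m<n} sin(mt)` -/
  obtain ⟨K, hK⟩ : ∃ K : ℕ → ℝ → ℝ, K = fun n t => ∑ m ∈ Finset.range n, sin ((m:ℝ) * t) := ⟨_, rfl⟩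
  have K_continuous : ∀ n, Continuous (K n) := by intro n; simp only [hK]; fun_prop
  have abs_K_le : ∀ (n : ℕ) (t : ℝ), |K n t| ≤ n := by
    intro n t
    simp only [hK]
    calc |∑ m ∈ Finset.range n, sin ((m:ℝ) * t)|
        ≤ ∑ m ∈ Finset.range n, |sin ((m:ℝ) * t)| := Finset.abs_sum_le_sum_abs _ _
      _ ≤ ∑ m ∈ Finset.range n, (1:ℝ) := Finset.sum_le_sum fun m _ => abs_sin_le_one _
      _ = n := by simp
  have two_sin_half_mul_K : ∀ (n : ℕ) (t : ℝ),
      2 * sin (t / 2) * K n t = cos (t / 2) - cos (((n:ℝ) - 1/2) * t) := by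
    intro n t
    induction n with
    | zero =>
      simp only [hK, Finset.range_zero, Finset.sum_empty, mul_zero, Nat.cast_zero, zero_sub]
      rw [show -(1/2 : ℝ) * t = -(t/2) by ring, cos_neg, sub_self]
    | succ n ih =>
      have hKs : K (n+1) t = K n t + sin ((n:ℝ) * t) := by simp [hK, Finset.sum_range_succ]
      have hp := two_mul_sin_mul_sin (t/2) ((n:ℝ) * t)
      have e1 : cos (t/2 - (n:ℝ) * t) = cos (((n:ℝ) - 1/2) * t) := by rw [← cos_neg]; congr 1; ring
      have e2 : cos (t/2 + (n:ℝ) * t) = cos (((↑(n+1):ℝ) - 1/2) * t) := by congr 1; push_cast; ring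
      rw [hKs]
      linear_combination ih + hp + e1 - e2
  have K_ge : ∀ (n : ℕ) {t : ℝ}, 0 < t → t ≤ π → -(1/2 : ℝ) ≤ K n t := by
    intro n t ht0 htπ
    have hs : 0 < sin (t/2) := sin_pos_of_pos_of_lt_pi (by linarith) (by linarith [pi_pos])
    have hc : 0 ≤ cos (t/2) := cos_nonneg_of_neg_pi_div_two_le_of_le (by linarith [pi_pos]) (by linarith)
    have h1 := two_sin_half_mul_K n t
    have h2 : cos (((n:ℝ) - 1/2) * t) ≤ 1 := cos_le_one _
    have h4 : 1 ≤ sin (t/2) + cos (t/2) := by nlinarith [mul_nonneg hs.le hc, sin_sq_add_cos_sq (t/2)]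
    by_contra hlt
    have : 2 * sin (t/2) * K n t < 2 * sin (t/2) * (-(1/2)) :=
      mul_lt_mul_of_pos_left (not_le.mp hlt) (by linarith)
    linarith
  have integral_K : ∀ (n : ℕ) (a b : ℝ),
      ∫ t in a..b, K n t = ∑ m ∈ Finset.range n, (cos ((m:ℝ) * a) - cos ((m:ℝ) * b)) / (m:ℝ) := by
    intro n a b
    simp only [hK]
    rw [intervalIntegral.integral_finsetSum (fun m _ => (by fun_prop : Continuous _).intervalIntegrable _ _)]
    refine Finset.sum_congr rfl fun m _ => ?_
    rcases Nat.eq_zero_or_pos m with rfl | hm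
    · simp
    · exact integral_sin_const_mul (by positivity) a b
  have sum_range_two_mul : ∀ (f : ℕ → ℝ) (M : ℕ),
      ∑ m ∈ Finset.range (2 * M), f m = ∑ i ∈ Finset.range M, (f (2 * i) + f (2 * i + 1)) := by
    intro f M
    induction M with
    | zero => simp
    | succ M ih =>
      rw [show 2 * (M + 1) = 2 * M + 1 + 1 by ring, Finset.sum_range_succ, Finset.sum_range_succ, ih,
        Finset.sum_range_succ]
      ring
  -- the bulk integral of `K (2M)` over `[1/(2M), π − 1/(2M)]` dominates `∑_{i<M} 1/(2i+1)`
  have sum_le_integral_K : ∀ M : ℕ, 1 ≤ M → ∑ i ∈ Finset.range M, 1 / (2 * (i:ℝ) + 1)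
      ≤ ∫ t in (1 / (2 * (M:ℝ)))..(π - 1 / (2 * (M:ℝ))), K (2 * M) t := by
    intro M hM
    have hMpos : (0:ℝ) < M := by exact_mod_cast hM
    rw [integral_K, sum_range_two_mul]
    refine Finset.sum_le_sum fun i hi => ?_
    have hi'' : (i:ℝ) + 1 ≤ M := by exact_mod_cast Finset.mem_range.mp hi
    set x : ℝ := 1 / (2 * (M:ℝ)) with hx
    have e1 : cos (((2 * i + 1 : ℕ):ℝ) * (π - x)) = -cos (((2 * i + 1 : ℕ):ℝ) * x) := by
      rw [mul_sub, cos_sub, cos_nat_mul_pi, sin_nat_mul_pi]; simp [pow_succ, pow_mul]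
    have e2 : cos (((2 * i : ℕ):ℝ) * (π - x)) = cos (((2 * i : ℕ):ℝ) * x) := by
      rw [mul_sub, cos_sub, cos_nat_mul_pi, sin_nat_mul_pi]; simp [pow_mul]
    rw [e1, e2, sub_self, zero_div, zero_add]
    have hy1 : ((2 * i + 1 : ℕ):ℝ) * x ≤ 1 := by
      push_cast
      rw [hx, mul_one_div, div_le_one (by positivity)]
      linarith
    have hcos : 1/2 ≤ cos (((2 * i + 1 : ℕ):ℝ) * x) := by
      have hy0 : 0 ≤ ((2 * i + 1 : ℕ):ℝ) * x := by positivity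
      nlinarith [one_sub_sq_div_two_le_cos (x := ((2 * i + 1 : ℕ):ℝ) * x)]
    have hc : ((2 * i + 1 : ℕ) : ℝ) = 2 * (i:ℝ) + 1 := by push_cast; ring
    rw [hc] at hcos ⊢
    rw [div_le_div_iff_of_pos_right (by positivity)]
    linarith
  -- `∑_{i<M} 1/(2i+1) ≥ log(M+1)/2`
  have log_le_sum_odd_inv : ∀ M : ℕ,
      Real.log ((M:ℝ) + 1) / 2 ≤ ∑ i ∈ Finset.range M, 1 / (2 * (i:ℝ) + 1) := by
    intro M
    have key : ∀ i : ℕ, Real.log ((i:ℝ) + 2) - Real.log ((i:ℝ) + 1) ≤ 1 / ((i:ℝ) + 1) := by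
      intro i
      have hpos : (0:ℝ) < (i:ℝ) + 1 := by positivity
      rw [← Real.log_div (by positivity) hpos.ne']
      calc _ ≤ ((i:ℝ) + 2) / ((i:ℝ) + 1) - 1 := log_le_sub_one_of_pos (by positivity)
        _ = 1 / ((i:ℝ) + 1) := by field_simp; ring
    have tele : ∀ n : ℕ, ∑ i ∈ Finset.range n, (Real.log ((i:ℝ) + 2) - Real.log ((i:ℝ) + 1))
        = Real.log ((n:ℝ) + 1) := by
      intro n
      induction n with
      | zero => simp
      | succ n ih =>
        rw [Finset.sum_range_succ, ih, show ((n:ℝ) + 2) = ((↑(n+1):ℝ) + 1) by push_cast; ring]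
        ring
    calc Real.log ((M:ℝ) + 1) / 2
        = (1/2) * ∑ i ∈ Finset.range M, (Real.log ((i:ℝ) + 2) - Real.log ((i:ℝ) + 1)) := by
          rw [tele]; ring
      _ ≤ (1/2) * ∑ i ∈ Finset.range M, 1 / ((i:ℝ) + 1) := by
          gcongr with i hi
          exact key i
      _ = ∑ i ∈ Finset.range M, 1 / (2 * ((i:ℝ) + 1)) := by
          rw [Finset.mul_sum]
          exact Finset.sum_congr rfl fun i _ => by rw [one_div_mul_one_div]
      _ ≤ ∑ i ∈ Finset.range M, 1 / (2 * (i:ℝ) + 1) :=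
          Finset.sum_le_sum fun i _ => one_div_le_one_div_of_le (by positivity) (by linarith)
  have sin_ge_sin : ∀ {x t : ℝ}, 0 ≤ x → x ≤ π / 2 → t ∈ Set.Icc x (π - x) → sin x ≤ sin t := by
    intro x t hx0 hx ht
    rcases le_or_gt t (π/2) with h | h
    · exact sin_le_sin_of_le_of_le_pi_div_two (by linarith [pi_pos]) h ht.1
    · rw [← sin_pi_sub t]
      exact sin_le_sin_of_le_of_le_pi_div_two (by linarith [pi_pos]) (by linarith) (by linarith [ht.2])
  /- quantitative core, for an abstract `M` with `log (M+1) ≥ 177` -/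
  suffices core : ∀ M : ℕ, 1 ≤ M → 177 ≤ Real.log ((M:ℝ) + 1) → False by
    refine core (2 ^ 256) Nat.one_le_two_pow ?_
    have h2 : Real.log ((2:ℝ) ^ 256) ≤ Real.log (((2 ^ 256 : ℕ) : ℝ) + 1) :=
      Real.log_le_log (by positivity) (by push_cast; linarith)
    rw [Real.log_pow] at h2
    push_cast at h2 ⊢
    linarith [Real.log_two_gt_d9]
  intro M hM1 hlogM
  have hM1r : (1:ℝ) ≤ M := by exact_mod_cast hM1
  obtain ⟨x, hx⟩ : ∃ x : ℝ, x = 1 / (2 * (M:ℝ)) := ⟨_, rfl⟩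
  have hx0 : 0 < x := by rw [hx]; positivity
  have hxle : x ≤ 1 / 2 := by rw [hx, div_le_div_iff_of_pos_left (by norm_num) (by positivity) (by norm_num)]; linarith
  have hπ3 := pi_gt_three; have hπ4 := pi_lt_d2
  have hxπ : x ≤ π / 2 := by linarith
  obtain ⟨ε, hε⟩ : ∃ ε : ℝ, ε = (2 / π * x) ^ 2 := ⟨_, rfl⟩
  have h2πx : 0 < 2 / π * x := by positivity
  have hsqrtε : Real.sqrt ε = 2 / π * x := by rw [hε]; exact sqrt_sq h2πx.le
  have hε0 : 0 < ε := by rw [hε]; positivity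
  have hε1 : ε < 1 := by
    have : 2 / π < 1 := by rw [div_lt_one (by linarith)]; linarith
    have h1 : 2 / π * x < 1 := by nlinarith
    rw [hε]; nlinarith
  obtain ⟨ℓ, hℓ⟩ : ∃ ℓ : ℕ, C * Real.log (2 / (4/5:ℝ)) ^ 2 / Real.sqrt ε ≤ ℓ := ⟨_, Nat.le_ceil _⟩
  obtain ⟨l, -, -, hband, hgap, D, b, hcert, htail⟩ :=
    h ε (4/5) 4 ℓ hε0 hε1 (by norm_num) (by norm_num) (by norm_num) hℓ
  obtain ⟨q, hq⟩ : ∃ q : ℝ → ℝ, q = fun (t : ℝ) => ((l.map fun z => ‖((t : ℝ) : ℂ) - z‖ ^ 2).prod) := ⟨_, rfl⟩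
  have hq0 : ∀ t, 0 ≤ q t := fun t => by
    rw [hq]
    exact List.prod_nonneg fun a ha => by obtain ⟨z, -, rfl⟩ := List.mem_map.mp ha; positivity
  have hband' : ∀ t : ℝ, Real.sqrt ε * 4 ≤ |t| → |t| ≤ 4 →
      |t| * q t - 1 ≤ 4/5 ∧ 1 - |t| * q t ≤ 4/5 := by rw [hq]; exact hband
  have hgap' : ∀ t : ℝ, |t| ≤ Real.sqrt ε * 4 → |t| * q t ≤ 1 + 4/5 := by rw [hq]; exact hgap
  have hcert' : ∀ t : ℝ, |t| ≤ 4 → t * q t = ∑ j ∈ Finset.range (D + 1),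
      b j * (Polynomial.Chebyshev.T ℝ (j : ℤ)).eval (t / 4) := by rw [hq]; exact hcert
  clear hband hgap hcert
  -- the certificate at `d = 0`: total coefficient mass ≤ δ⁻⁸ = (5/4)⁸
  have hsumabs : ∑ j ∈ Finset.range (D + 1), |b j| ≤ 390625 / 65536 := by
    have h0 := htail 0
    have e1 : ∀ j : ℕ, (if 0 ≤ j then |b j| else (0:ℝ)) = |b j| := fun j => if_pos (Nat.zero_le j)
    simp only [e1, Nat.cast_zero, zero_div, neg_zero, exp_zero, mul_one] at h0
    norm_num at h0
    exact h0
  -- `F θ = ∑ b_j cos(jθ) = (4 cos θ) q(4 cos θ)` and `G t = F(π/2 − t) − F(π/2 + t)`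
  obtain ⟨F, hF⟩ : ∃ F : ℝ → ℝ, F = fun θ => ∑ j ∈ Finset.range (D + 1), b j * cos ((j:ℝ) * θ) :=
    ⟨_, rfl⟩
  obtain ⟨G, hG⟩ : ∃ G : ℝ → ℝ, G = fun t => F (π / 2 - t) - F (π / 2 + t) := ⟨_, rfl⟩
  have hFc : Continuous F := by simp only [hF]; fun_prop
  have hGc : Continuous G := by rw [hG]; exact (hFc.comp (by fun_prop)).sub (hFc.comp (by fun_prop))
  have hT : ∀ θ, |4 * cos θ| ≤ 4 := fun θ => by rw [abs_mul, Nat.abs_ofNat]; linarith [abs_cos_le_one θ]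
  have hFP : ∀ θ, F θ = (4 * cos θ) * q (4 * cos θ) := by
    intro θ
    rw [hcert' _ (hT θ)]
    simp only [hF]
    refine Finset.sum_congr rfl fun j _ => ?_
    simp only [show 4 * cos θ / 4 = cos θ by ring, Polynomial.Chebyshev.T_real_cos, Int.cast_natCast]
  have hF_abs : ∀ θ, |F θ| ≤ 1 + 4/5 := by
    intro θ
    rw [hFP, abs_mul (4 * cos θ), abs_of_nonneg (hq0 _)]
    rcases le_total (Real.sqrt ε * 4) |4 * cos θ| with hbig | hsmall
    · linarith [(hband' _ hbig (hT θ)).1]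
    · linarith [hgap' _ hsmall]
  have hF_lower : ∀ t, Real.sqrt ε ≤ sin t → 1 - 4/5 ≤ F (π / 2 - t) ∧ F (π / 2 + t) ≤ -(1 - 4/5) := by
    intro t ht
    have hspos : 0 < sin t := lt_of_lt_of_le (by rw [hsqrtε]; exact h2πx) ht
    have hs1 : sin t ≤ 1 := sin_le_one t; have hTpos : 0 < 4 * sin t := by positivity
    constructor
    · rw [hFP, cos_pi_div_two_sub]
      have habs : |4 * sin t| = 4 * sin t := abs_of_pos hTpos
      have := (hband' _ (by rw [habs]; linarith) (by rw [habs]; linarith)).2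
      rw [habs] at this; linarith
    · rw [hFP, add_comm, cos_add_pi_div_two]
      have habs : |4 * -sin t| = 4 * sin t := by rw [mul_neg, abs_neg, abs_of_pos hTpos]
      have := (hband' _ (by rw [habs]; linarith) (by rw [habs]; linarith)).2
      rw [habs] at this
      nlinarith [hq0 (4 * -sin t)]
  have G_expand : ∀ t, G t = ∑ j ∈ Finset.range (D + 1), 2 * b j * sin ((j:ℝ) * (π / 2)) * sin ((j:ℝ) * t) := by
    intro t
    simp only [hG, hF, ← Finset.sum_sub_distrib]
    refine Finset.sum_congr rfl fun j _ => ?_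
    rw [mul_sub, mul_add]
    linear_combination (-(b j)) * two_mul_sin_mul_sin ((j:ℝ) * (π / 2)) ((j:ℝ) * t)
  -- (I) orthogonality: `∫₀^π G K_n ≤ π ∑ |b_j| ≤ π δ⁻⁸`
  have hI_upper : ∫ t in (0:ℝ)..π, G t * K (2 * M) t ≤ π * (390625 / 65536) := by
    set n := 2 * M with hn
    have e : ∀ t, G t * K n t = ∑ j ∈ Finset.range (D + 1), ∑ m ∈ Finset.range n,
        2 * b j * sin ((j:ℝ) * (π / 2)) * (sin ((j:ℝ) * t) * sin ((m:ℝ) * t)) := by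
      intro t
      rw [G_expand t]
      simp only [hK]
      rw [Finset.sum_mul]
      refine Finset.sum_congr rfl fun j _ => ?_
      rw [Finset.mul_sum]
      exact Finset.sum_congr rfl fun m _ => by ring
    have hcomp : ∫ t in (0:ℝ)..π, G t * K n t = ∑ j ∈ Finset.range (D + 1),
        2 * b j * sin ((j:ℝ) * (π / 2)) * ∑ m ∈ Finset.range n, (if j = m ∧ 1 ≤ m then π / 2 else 0) := by
      simp_rw [e]
      rw [intervalIntegral.integral_finsetSum (fun j _ => (by fun_prop : Continuous _).intervalIntegrable _ _)]
      refine Finset.sum_congr rfl fun j _ => ?_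
      rw [intervalIntegral.integral_finsetSum (fun m _ => (by fun_prop : Continuous _).intervalIntegrable _ _),
        Finset.mul_sum]
      refine Finset.sum_congr rfl fun m _ => ?_
      rw [intervalIntegral.integral_const_mul, integral_sin_mul_sin]
    have hle : ∫ t in (0:ℝ)..π, G t * K n t ≤ π * ∑ j ∈ Finset.range (D + 1), |b j| := by
      rw [hcomp, Finset.mul_sum]
      refine Finset.sum_le_sum fun j _ => ?_
      set S := ∑ m ∈ Finset.range n, (if j = m ∧ 1 ≤ m then π / 2 else (0:ℝ)) with hS
      have h0 : 0 ≤ S := Finset.sum_nonneg fun m _ => by split_ifs <;> linarith [pi_pos]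
      have h1 : S ≤ π / 2 := by
        calc S ≤ ∑ m ∈ Finset.range n, (if j = m then π / 2 else (0:ℝ)) := by
              refine Finset.sum_le_sum fun m _ => ?_
              by_cases hjm : j = m <;> by_cases hm : 1 ≤ m <;> simp [hjm, hm]
              positivity
          _ = if j ∈ Finset.range n then π / 2 else 0 := Finset.sum_ite_eq _ _ _
          _ ≤ π / 2 := by split_ifs <;> linarith [pi_pos]
      calc 2 * b j * sin ((j:ℝ) * (π / 2)) * S ≤ |2 * b j * sin ((j:ℝ) * (π / 2)) * S| := le_abs_self _
        _ = 2 * |b j| * |sin ((j:ℝ) * (π / 2))| * S := by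
            rw [abs_mul, abs_mul, abs_mul, abs_of_nonneg h0, abs_two]
        _ ≤ 2 * |b j| * 1 * (π / 2) := by gcongr; exact abs_sin_le_one _
        _ = π * |b j| := by ring
    exact hle.trans (by gcongr)
  -- (II) near-square-wave lower bound
  have hint : ∀ a c : ℝ, IntervalIntegrable (fun t => G t * K (2 * M) t) volume a c :=
    fun a c => (hGc.mul (K_continuous _)).intervalIntegrable a c
  have hsplit : ∫ t in (0:ℝ)..π, G t * K (2 * M) t
      = (∫ t in (0:ℝ)..x, G t * K (2 * M) t) + (∫ t in x..(π - x), G t * K (2 * M) t)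
        + ∫ t in (π - x)..π, G t * K (2 * M) t := by
    rw [intervalIntegral.integral_add_adjacent_intervals (hint _ _) (hint _ _),
      intervalIntegral.integral_add_adjacent_intervals (hint _ _) (hint _ _)]
  have hGK_bound : ∀ t, ‖G t * K (2 * M) t‖ ≤ 2 * (1 + 4/5) * (2 * (M:ℝ)) := by
    intro t
    rw [norm_eq_abs, abs_mul]
    have h1 : |G t| ≤ 2 * (1 + 4/5) := by
      have := (abs_sub (F (π / 2 - t)) (F (π / 2 + t))).trans (add_le_add (hF_abs _) (hF_abs _))
      simp only [hG]; linarith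
    have h2 : |K (2 * M) t| ≤ 2 * (M:ℝ) := by have := abs_K_le (2 * M) t; push_cast at this; exact this
    exact mul_le_mul h1 h2 (abs_nonneg _) (by norm_num)
  have hlenval : 2 * (1 + 4/5) * (2 * (M:ℝ)) * x = 2 * (1 + 4/5) := by rw [hx]; field_simp
  have hgap1 : -(2 * (1 + 4/5)) ≤ ∫ t in (0:ℝ)..x, G t * K (2 * M) t := by
    have := intervalIntegral.norm_integral_le_of_norm_le_const (a := 0) (b := x) (fun t _ => hGK_bound t)
    rw [norm_eq_abs, sub_zero, abs_of_pos hx0, hlenval] at this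
    exact (abs_le.mp this).1
  have hgap2 : -(2 * (1 + 4/5)) ≤ ∫ t in (π - x)..π, G t * K (2 * M) t := by
    have := intervalIntegral.norm_integral_le_of_norm_le_const (a := π - x) (b := π) (fun t _ => hGK_bound t)
    rw [norm_eq_abs, show π - (π - x) = x by ring, abs_of_pos hx0, hlenval] at this
    exact (abs_le.mp this).1
  have hbulk : (2 - 2 * (4/5)) * (∑ i ∈ Finset.range M, 1 / (2 * (i:ℝ) + 1)) - 2 * (4/5) * π
      ≤ ∫ t in x..(π - x), G t * K (2 * M) t := by
    have hxπ' : x ≤ π - x := by linarith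
    have hmono : ∫ t in x..(π - x), ((2 - 2 * (4/5)) * K (2 * M) t - 2 * (4/5))
        ≤ ∫ t in x..(π - x), G t * K (2 * M) t := by
      apply intervalIntegral.integral_mono_on hxπ'
        (((K_continuous _).const_mul _ |>.sub continuous_const).intervalIntegrable _ _) (hint _ _)
      intro t ht
      obtain ⟨h1, h2⟩ := hF_lower t (by
        rw [hsqrtε]; exact (mul_le_sin hx0.le hxπ).trans (sin_ge_sin hx0.le hxπ ht))
      have hglo : 2 - 2 * (4/5) ≤ G t := by simp only [hG]; linarith
      have hghi : G t ≤ 2 + 2 * (4/5) := by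
        have ha := abs_le.mp (hF_abs (π / 2 - t)); have hb := abs_le.mp (hF_abs (π / 2 + t))
        simp only [hG]; linarith
      have hKlo : -(1/2) ≤ K (2 * M) t := K_ge _ (by linarith [ht.1]) (by linarith [ht.2])
      show (2 - 2 * (4/5)) * K (2 * M) t - 2 * (4/5) ≤ G t * K (2 * M) t
      rcases le_or_gt 0 (K (2 * M) t) with hK0 | hK0
      · nlinarith [mul_nonneg (sub_nonneg.mpr hglo) hK0]
      · nlinarith [mul_nonneg_of_nonpos_of_nonpos (sub_nonpos.mpr hghi) hK0.le]
    have hKint : ∫ t in x..(π - x), ((2 - 2 * (4/5)) * K (2 * M) t - 2 * (4/5))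
        = (2 - 2 * (4/5)) * (∫ t in x..(π - x), K (2 * M) t) - 2 * (4/5) * (π - x - x) := by
      rw [intervalIntegral.integral_sub (((K_continuous _).const_mul _).intervalIntegrable _ _)
        (by simp), intervalIntegral.integral_const_mul, intervalIntegral.integral_const, smul_eq_mul]
      ring
    have hKge := sum_le_integral_K M hM1
    rw [← hx] at hKge
    linarith [hmono, hKint, hKge, hx0]
  linarith [hI_upper, hsplit, hgap1, hgap2, hbulk, log_le_sum_odd_inv M, hlogM, pi_pos]

end Summit.QuantumFields.QCD.Theorems
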